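import Mathlib
import HarnessLib
import Summits.NavierStokesRegularity.NavierStokesRegularity.Theorems.TaylorModelRungThreeCertificateIntervalDMatrixBounds

/-!
# Crux K1b-DR (stmt-NavierStokesRegularity-23954), line `taylor-model` — certificate SOUNDNESS, v3 FRAMES: the NEUMANN
# inverse-enclosure test `checkInvFrame` and its soundness (CERT-CONTRACT-23954 v3.1 §4 F-b; PROPAGATE-V-SPEC-cert1 §2 D;
# director ruling dss_60 «frames checker-maintained by a deterministic dyadic rule»)

The v3 checker re-orthonormalises the error frame at every node (Lohner's QR absorption) and never stores an exact inverse: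
for the freshly chosen point frame `C` (an `n × n` dyadic matrix) it computes an APPROXIMATE inverse `X` by any rounded rule,
forms the interval enclosure `oneSubMulDD X C ∋ I − X·C`, and tests `‖I − X·C‖_∞ ≤ θ` (upward interval row sums of
magnitudes), `θ < 1`, `θ + θ·φ ≤ φ` — the Boolean `checkInvFrame n prec X C θ φ`. SOUNDNESS
(`exists_inv_of_checkInvFrame`): then the real matrix of `C` is invertible and its two-sided inverse `g` (in window
coordinates, `Finset.range n` sums) lies ENTRYWISE in `ciBox X φ = X ⊕ [−φ·m_c, φ·m_c]`, `m_c = max_r |X r c|` — so the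
chain's exact-frame clause (`Ci·Cm = Cm·Ci = id` on the window, `TaylorModelV.ChainVCore` a-block) is witnessed by `g`, and
every interval product with `CiBox` (`T_s = CiBox·[M_s]·Cm`, `|CiBox|·ν`) encloses the corresponding product with the true
inverse. The mathematics is the pure matrix-algebra lemma `Matrix.isUnit_and_inv_sub_le_of_rowSum` over
`Matrix (Fin n) (Fin n) ℝ`: `‖I − XC‖_∞ ≤ θ < 1` ⇒ `XC` has trivial kernel (a fixed point `u = (I − XC)u` has
`‖u‖_∞ ≤ θ‖u‖_∞`) ⇒ `C` is a unit; and `D := C⁻¹ − X` satisfies `D = (I − XC)·X + (I − XC)·D`, whence column by column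
`max_i |D i c| ≤ θ·m_c + θ·max_i |D i c|`, i.e. `|D i c| ≤ θ/(1−θ)·m_c ≤ φ·m_c` (ewr3 `make_frame`: `emax/fb/Binv`,
validated run j300188). References: A. Neumaier, *Interval Methods for Systems of Equations* (1990) §3.6–3.7, §4.1
(approximate inverse, Neumann series, Krawczyk-type enclosures); R. J. Lohner, *Einschließung der Lösung gewöhnlicher
Anfangs- und Randwertaufgaben* (1988) §2 (QR frames). [folklore]
MODEL-lattice bookkeeping only (rung TL-M3, one finite-dimensional model ODE); nothing here concerns the Navier–Stokes equations.
-/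

-- the sub-problem namespace repeats the summit name by design (D-0017)
set_option linter.dupNamespace false

namespace Summit.NavierStokesRegularity.NavierStokesRegularity.Theorems.TaylorModelCert

open scoped BigOperators
open Matrix

/-! ### The matrix-algebra lemma over `ℝ` -/

section Real

variable {n : ℕ}

/-- Row-sum bound ⇒ `∞`-norm action bound: `Σ_j |E i j| ≤ θ` and `|v j| ≤ M` for all `j` give `|(E v) i| ≤ θ·M`.
[folklore] -/
theorem Matrix.abs_mulVec_le_of_rowSum (E : Matrix (Fin n) (Fin n) ℝ) {θ : ℝ} (hE : ∀ i, ∑ j, |E i j| ≤ θ)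
    (v : Fin n → ℝ) {M : ℝ} (hv : ∀ j, |v j| ≤ M) (i : Fin n) : |(E *ᵥ v) i| ≤ θ * M := by
  have hM : 0 ≤ M := (abs_nonneg _).trans (hv i)
  calc |(E *ᵥ v) i| = |∑ j, E i j * v j| := by simp [Matrix.mulVec, dotProduct]
    _ ≤ ∑ j, |E i j * v j| := Finset.abs_sum_le_sum_abs _ _
    _ = ∑ j, |E i j| * |v j| := by simp only [abs_mul]
    _ ≤ ∑ j, |E i j| * M := Finset.sum_le_sum fun j _ => mul_le_mul_of_nonneg_left (hv j) (abs_nonneg _)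
    _ = (∑ j, |E i j|) * M := by rw [Finset.sum_mul]
    _ ≤ θ * M := mul_le_mul_of_nonneg_right (hE i) hM

/-- **Approximate-inverse lemma (Neumann).** If `‖I − X·C‖_∞ ≤ θ < 1` (row sums) then `C` is a unit, and with
`θ + θ·φ ≤ φ` and column bounds `|X k c| ≤ m c` the inverse satisfies `|(C⁻¹ − X) i c| ≤ φ · m c`.
[folklore; cite Neumaier 1990 §3.7] -/
theorem Matrix.isUnit_and_inv_sub_le_of_rowSum (X C : Matrix (Fin n) (Fin n) ℝ) {θ φ : ℝ}
    (hE : ∀ i, ∑ j, |(1 - X * C) i j| ≤ θ) (hθ : θ < 1) (hφ : θ + θ * φ ≤ φ) {m : Fin n → ℝ}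
    (hm : ∀ k c, |X k c| ≤ m c) : IsUnit C ∧ ∀ i c, |(C⁻¹ - X) i c| ≤ φ * m c := by
  set E : Matrix (Fin n) (Fin n) ℝ := 1 - X * C with hEdef
  have hrow := Matrix.abs_mulVec_le_of_rowSum E hE
  -- `X·C = I − E` has trivial kernel
  have hinj : Function.Injective (X * C).mulVec := by
    intro v w hvw
    have h0 : (X * C) *ᵥ (v - w) = 0 := by rw [Matrix.mulVec_sub, hvw, sub_self]
    have hfix : v - w = E *ᵥ (v - w) := by
      have : E *ᵥ (v - w) = (v - w) - (X * C) *ᵥ (v - w) := by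
        rw [hEdef, Matrix.sub_mulVec, Matrix.one_mulVec]
      rw [this, h0, sub_zero]
    rcases isEmpty_or_nonempty (Fin n) with hn | hn
    · exact sub_eq_zero.1 (funext fun i => (IsEmpty.false i).elim)
    · obtain ⟨i₀, -, hi₀⟩ := Finset.exists_max_image Finset.univ (fun j => |(v - w) j|) Finset.univ_nonempty
      have hb := hrow (v - w) (fun j => hi₀ j (Finset.mem_univ j)) i₀
      rw [← hfix] at hb
      have hz : |(v - w) i₀| ≤ 0 := by nlinarith [abs_nonneg ((v - w) i₀), hb, hθ]
      exact sub_eq_zero.1 (funext fun j =>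
        abs_eq_zero.1 (le_antisymm ((hi₀ j (Finset.mem_univ j)).trans hz) (abs_nonneg _)))
  have hCinj : Function.Injective C.mulVec := by
    intro v w h
    apply hinj
    show (X * C) *ᵥ v = (X * C) *ᵥ w
    rw [← Matrix.mulVec_mulVec, ← Matrix.mulVec_mulVec, h]
  have hC : IsUnit C := Matrix.mulVec_injective_iff_isUnit.1 hCinj
  refine ⟨hC, ?_⟩
  have hCdet : IsUnit C.det := (Matrix.isUnit_iff_isUnit_det C).1 hC
  -- `D := C⁻¹ − X` satisfies `D = E·X + E·D`
  set D : Matrix (Fin n) (Fin n) ℝ := C⁻¹ - X with hD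
  have hDeq : D = E * X + E * D := by
    have h1 : X + D = C⁻¹ := by rw [hD]; abel
    rw [← mul_add, h1, hEdef, sub_mul, one_mul, Matrix.mul_assoc, Matrix.mul_nonsing_inv C hCdet, mul_one]
  intro i c
  obtain ⟨i₀, -, hi₀⟩ := Finset.exists_max_image Finset.univ (fun k => |D k c|) ⟨i, Finset.mem_univ i⟩
  have hmc : 0 ≤ m c := (abs_nonneg _).trans (hm i c)
  have key : |D i₀ c| ≤ θ * m c + θ * |D i₀ c| := by
    have e1 : D i₀ c = (E *ᵥ fun k => X k c) i₀ + (E *ᵥ fun k => D k c) i₀ := by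
      conv_lhs => rw [hDeq]
      simp [Matrix.add_apply, Matrix.mul_apply, Matrix.mulVec, dotProduct]
    conv_lhs => rw [e1]
    exact (abs_add_le _ _).trans
      (add_le_add (hrow _ (fun k => hm k c) i₀) (hrow _ (fun k => hi₀ k (Finset.mem_univ k)) i₀))
  have h1θ : 0 < 1 - θ := by linarith
  have hθm : θ * m c ≤ φ * (1 - θ) * m c := by
    have : θ ≤ φ * (1 - θ) := by linarith
    exact mul_le_mul_of_nonneg_right this hmc
  have hμ : |D i₀ c| ≤ φ * m c := by
    have h2 : |D i₀ c| * (1 - θ) ≤ φ * m c * (1 - θ) := by nlinarith [key, hθm]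
    exact le_of_mul_le_mul_right h2 h1θ
  exact (hi₀ i (Finset.mem_univ i)).trans hμ

end Real

/-! ### The array-coded test and its soundness in window coordinates -/

section Check

/-- The `Fin n`-indexed real matrix of a coordinate function. [folklore] -/
def toMat (n : ℕ) (a : ℕ → ℕ → ℝ) : Matrix (Fin n) (Fin n) ℝ := Matrix.of fun i j => a i j

/-- **Neumann FRAME-INVERSE TEST**: `‖I − X·C‖_∞ ≤ θ` on the interval enclosure `oneSubMulDD X C` (upward row sums of
magnitudes), `θ < 1`, and `θ + θ·φ ≤ φ` (so `θ/(1−θ) ≤ φ`; e.g. `φ = θ + 2θ²` passes whenever `θ ≤ 1/2`). [folklore] -/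
def checkInvFrame (n prec : ℕ) (X C : Array (Array Dyad)) (θ φ : Dyad) : Bool :=
  checkRowSumLe n prec (oneSubMulDD n prec X C) θ && Dyad.blt θ Dyad.one &&
    Dyad.ble (Dyad.add θ (Dyad.mul θ φ)) φ

variable {n : ℕ} (prec : ℕ)

/-- Range sums as `Fin` sums (bridge to `Matrix`). [folklore] -/
private theorem sum_range_eq_univ (f : ℕ → ℝ) : ∑ t ∈ Finset.range n, f t = ∑ t : Fin n, f t :=
  Finset.sum_range f

/-- **Soundness of the frame-inverse test.** If `checkInvFrame n prec X C θ φ` passes, the real matrix of `C` has a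
two-sided inverse `g` in window coordinates, and `g ∈ ciBox X φ` entrywise. [folklore; cite Neumaier 1990 §3.7] -/
theorem exists_inv_of_checkInvFrame {X C : Array (Array Dyad)} {θ φ : Dyad}
    (h : checkInvFrame n prec X C θ φ = true) :
    ∃ g : ℕ → ℕ → ℝ,
      (∀ r < n, ∀ c < n, ∑ t ∈ Finset.range n, dre C r t * g t c = if r = c then 1 else 0) ∧
      (∀ r < n, ∀ c < n, ∑ t ∈ Finset.range n, g r t * dre C t c = if r = c then 1 else 0) ∧
      MemMat n g (ciBox n X φ) := by
  simp only [checkInvFrame, Bool.and_eq_true] at h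
  obtain ⟨⟨hrs, hθ1⟩, hφ⟩ := h
  have hθ : θ.toReal < 1 := by simpa using (Dyad.blt_iff _ _).1 hθ1
  have hφ' : θ.toReal + θ.toReal * φ.toReal ≤ φ.toReal := by
    simpa [Dyad.toReal_add, Dyad.toReal_mul] using (Dyad.ble_iff _ _).1 hφ
  set Xm : Matrix (Fin n) (Fin n) ℝ := toMat n (dre X) with hXm
  set Cm : Matrix (Fin n) (Fin n) ℝ := toMat n (dre C) with hCm
  -- the row sums of `I − Xm·Cm`
  have hE : ∀ i : Fin n, ∑ j : Fin n, |(1 - Xm * Cm) i j| ≤ θ.toReal := by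
    intro i
    have hrow := rowSum_le_of_checkRowSumLe prec (memMat_oneSubMulDD (n := n) prec X C) hrs i.isLt
    rw [sum_range_eq_univ] at hrow
    refine le_of_eq_of_le (Finset.sum_congr rfl fun j _ => ?_) hrow
    congr 1
    rw [sum_range_eq_univ]
    simp only [Matrix.sub_apply, Matrix.one_apply, Matrix.mul_apply, hXm, hCm, toMat, Matrix.of_apply, Fin.ext_iff]
  have hm : ∀ k c : Fin n, |Xm k c| ≤ (colMaxAbs X c n).toReal := fun k c => by
    simp only [hXm, toMat, Matrix.of_apply]
    exact abs_le_colMaxAbs X c k.isLt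
  obtain ⟨hC, hbd⟩ := Matrix.isUnit_and_inv_sub_le_of_rowSum Xm Cm hE hθ hφ' hm
  have hCdet : IsUnit Cm.det := (Matrix.isUnit_iff_isUnit_det Cm).1 hC
  -- the inverse in coordinates
  let g : ℕ → ℕ → ℝ := fun r c => if hr : r < n then (if hc : c < n then Cm⁻¹ ⟨r, hr⟩ ⟨c, hc⟩ else 0) else 0
  have hg : ∀ {r c : ℕ} (hr : r < n) (hc : c < n), g r c = Cm⁻¹ ⟨r, hr⟩ ⟨c, hc⟩ := fun hr hc => by
    simp only [g, dif_pos hr, dif_pos hc]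
  refine ⟨g, fun r hr c hc => ?_, fun r hr c hc => ?_, memMat_ciBox fun r hr c hc => ?_⟩
  · have e := congrFun (congrFun (Matrix.mul_nonsing_inv Cm hCdet) ⟨r, hr⟩) ⟨c, hc⟩
    rw [Matrix.mul_apply] at e
    have e' : ∑ t : Fin n, dre C r t * g t c = ∑ j, Cm ⟨r, hr⟩ j * Cm⁻¹ j ⟨c, hc⟩ :=
      Finset.sum_congr rfl fun t _ => by rw [hg t.isLt hc]; simp [hCm, toMat]
    rw [sum_range_eq_univ, e', e, Matrix.one_apply]
    simp
  · have e := congrFun (congrFun (Matrix.nonsing_inv_mul Cm hCdet) ⟨r, hr⟩) ⟨c, hc⟩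
    rw [Matrix.mul_apply] at e
    have e' : ∑ t : Fin n, g r t * dre C t c = ∑ j, Cm⁻¹ ⟨r, hr⟩ j * Cm j ⟨c, hc⟩ :=
      Finset.sum_congr rfl fun t _ => by rw [hg hr t.isLt]; simp [hCm, toMat]
    rw [sum_range_eq_univ, e', e, Matrix.one_apply]
    simp
  · have hb := hbd ⟨r, hr⟩ ⟨c, hc⟩
    rw [Matrix.sub_apply] at hb
    rw [hg hr hc]
    simpa [hXm, toMat] using hb

end Check

end Summit.NavierStokesRegularity.NavierStokesRegularity.Theorems.TaylorModelCert
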